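import Literature.AlgebraicGeometry.Resolution.BlowupFittingIdealFlatCartier
import HarnessLib

/-!
# Flatness of the strict transform along a `U`-admissible blowing up (Raynaud–Gruson 5.4.2,
# Stacks 0811, admissible form)

Topic: `Literature/AlgebraicGeometry/Resolution`. `BlowupFittingIdealFlatCartier.lean` treats
the strict transform over a chart on which the Fitting ideal `I = Fit_r(B)` becomes principal
`(b)` and the `b`-power torsion is killed. For Raynaud–Gruson flattening in the form of
Stacks 081R / 0811 one blows up a centre supported on `S ∖ U` — e.g. `K · Fit_r(B)` with
`V(K) = S ∖ U` — and the strict transform kills the `c`-power torsion for a local equation `c`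
of THAT centre; on such a chart `I R' = (t₁)` is still principal (a factor of an invertible
ideal is invertible) with `t₁ ∣ c`, but `t₁` need not be a nonzerodivisor and the torsion
killed is the larger `c`-power torsion. This file proves the corresponding generalisation: let
`B` be a finite `R`-module with `Fit_r(B) = I`, locally free of rank `r` over `U = S ∖ V(K)`
(`Kⁿ Fit_k(B) = 0` for `k < r`), and `R'` an `R`-algebra with elements `t₁ ∣ c`,
`I R' = (t₁)`, `c` a nonzerodivisor some power of which lies in `K R'`. Then the strict
transform `(R' ⊗_R B)/(c-power torsion)` is a flat `R'`-module, locally free of rank `r`.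

* `pow_mul_mem_map_eq_zero` — `Kⁿ J = 0`, `cᵐ ∈ K R'` ⇒ `c^{mn}` kills `J R'`;
* `fittingIdeal_strictTransform_eq_bot_admissible`, `fittingIdeal_strictTransform_eq_top_admissible`,
  `nonempty_basis_localized_strictTransform_admissible`;
* `flat_strictTransform_admissible` — **the strict transform `(R' ⊗_R B)/(c-power torsion)` is
  flat over `R'`.**

## References

* M. Raynaud, L. Gruson, *Critères de platitude et de projectivité*, Invent. Math. 13 (1971),
  Première partie, 5.4.2. [RaynaudGruson1971]
* The Stacks Project, Tags 0810, 0811, 081R. [StacksProject]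
-/

namespace Literature.AlgebraicGeometry.Resolution

universe u

open TensorProduct Literature.RingTheory.FittingIdeal

variable {R : Type u} [CommRing R] {B : Type u} [AddCommGroup B] [Module R B]
variable {R' : Type u} [CommRing R'] [Algebra R R']

/-- If `Kⁿ J = 0` in `R` and `cᵐ ∈ K R'`, then `c^{m n}` kills `J R'`. [folklore] -/
theorem pow_mul_mem_map_eq_zero {K J : Ideal R} {c : R'} {m n : ℕ}
    (hc : c ^ m ∈ K.map (algebraMap R R')) (hn : K ^ n * J = ⊥) {y : R'}
    (hy : y ∈ J.map (algebraMap R R')) : c ^ (m * n) * y = 0 := by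
  have h1 : c ^ (m * n) * y ∈ (K ^ n * J).map (algebraMap R R') := by
    rw [Ideal.map_mul, Ideal.map_pow, pow_mul]
    exact Ideal.mul_mem_mul (Ideal.pow_mem_pow hc n) hy
  rw [hn, Ideal.map_bot] at h1
  exact (Submodule.mem_bot _).mp h1

/-- `Fit_k` of the strict transform (quotient by the `c`-power torsion) vanishes for `k < r`,
when `Kⁿ Fit_k(B) = 0`, `cᵐ ∈ K R'` and `c` is a nonzerodivisor of `R'`.
[cite: StacksProject, Tag 0810 (proof, Step 10)] -/
theorem fittingIdeal_strictTransform_eq_bot_admissible [Module.Finite R B] {K : Ideal R} {c : R'}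
    {m : ℕ} (hcK : c ^ m ∈ K.map (algebraMap R R')) (hc : c ∈ nonZeroDivisors R') {k : ℕ}
    (htors : ∃ n : ℕ, K ^ n * Module.fittingIdeal R B k = ⊥) :
    Module.fittingIdeal R' ((R' ⊗[R] B) ⧸ (⨆ n : ℕ, Submodule.torsionBy R' (R' ⊗[R] B) (c ^ n)))
      k = ⊥ := by
  obtain ⟨n, hn⟩ := htors
  have hN : (Module.fittingIdeal R' (R' ⊗[R] B) k).map
      (algebraMap R' (Localization (Submonoid.powers c))) = ⊥ := by
    rw [Module.fittingIdeal_baseChange, Ideal.map_eq_bot_iff_le_ker]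
    intro x hx
    rw [RingHom.mem_ker, IsLocalization.map_eq_zero_iff (Submonoid.powers c)]
    exact ⟨⟨c ^ (m * n), m * n, rfl⟩, pow_mul_mem_map_eq_zero hcK hn hx⟩
  rw [eq_bot_iff]
  intro x hx
  have hx' : algebraMap R' (Localization (Submonoid.powers c)) x = 0 := by
    have hmem := Ideal.mem_map_of_mem (algebraMap R' (Localization (Submonoid.powers c))) hx
    rw [map_fittingIdeal_quotient_powTorsion_eq, hN] at hmem
    exact (Submodule.mem_bot _).mp hmem
  obtain ⟨⟨_, e, rfl⟩, he⟩ := (IsLocalization.map_eq_zero_iff (Submonoid.powers c) _ _).mp hx'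
  exact (Submodule.mem_bot R').mpr ((mem_nonZeroDivisors_iff_right.mp (pow_mem hc e)) _
    (by rwa [mul_comm] at he))

/-- `Fit_r(N_𝔭) = (t₁)` at a prime, with `t₁ ∣ c`, forces `Fit_r(N/(c-power torsion)) ⊄ 𝔭`
(`N = R' ⊗_R B`): the localisation of the quotient at `𝔭` is a quotient of
`N_𝔭/{x ∣ t₁ x = 0}`, generated by `r` elements (Stacks 080Z), and Stacks 07ZC.
[cite: StacksProject, Tag 0810 (proof, Step 8)] -/
theorem not_fittingIdeal_strictTransform_le_admissible [Module.Finite R B] {r : ℕ} {t₁ c : R'}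
    (hdiv : t₁ ∣ c) (P : Ideal R') [P.IsPrime]
    (hFit : Module.fittingIdeal (Localization.AtPrime P)
      (LocalizedModule P.primeCompl (R' ⊗[R] B)) r =
        Ideal.span {algebraMap R' (Localization.AtPrime P) t₁}) :
    ¬ Module.fittingIdeal R' ((R' ⊗[R] B) ⧸ (⨆ n : ℕ, Submodule.torsionBy R' (R' ⊗[R] B)
      (c ^ n))) r ≤ P := by
  haveI : Module.Finite (Localization.AtPrime P) (LocalizedModule P.primeCompl (R' ⊗[R] B)) :=
    Module.Finite.of_isLocalizedModule P.primeCompl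
      (LocalizedModule.mkLinearMap P.primeCompl (R' ⊗[R] B))
  have h080Z := Module.exists_span_eq_top_quotient_torsionBy hFit
  have hle' := torsionBy_localized_le (N := R' ⊗[R] B)
    (Nₚ := LocalizedModule P.primeCompl (R' ⊗[R] B)) c P
    (Localization.AtPrime P) (LocalizedModule.mkLinearMap P.primeCompl (R' ⊗[R] B))
  -- `{x | t₁ x = 0} ⊆ {x | c x = 0}` as `t₁ ∣ c`
  have hle₁ : Submodule.torsionBy (Localization.AtPrime P) (LocalizedModule P.primeCompl (R' ⊗[R] B))
      (algebraMap R' (Localization.AtPrime P) t₁) ≤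
      Submodule.torsionBy (Localization.AtPrime P) (LocalizedModule P.primeCompl (R' ⊗[R] B))
        (algebraMap R' (Localization.AtPrime P) c) := by
    intro x hx
    obtain ⟨s, rfl⟩ := hdiv
    rw [Submodule.mem_torsionBy_iff] at hx ⊢
    rw [map_mul, mul_comm, mul_smul, hx, smul_zero]
  obtain ⟨y₁, hy₁⟩ := exists_span_eq_top_quotient_of_le (hle₁.trans hle') h080Z
  let e := localizedQuotientEquiv P.primeCompl
    (⨆ n : ℕ, Submodule.torsionBy R' (R' ⊗[R] B) (c ^ n))
  have hy : Submodule.span (Localization.AtPrime P) (Set.range (e ∘ y₁)) = ⊤ := by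
    rw [Set.range_comp, show (⇑e '' Set.range y₁) = ⇑e.toLinearMap '' Set.range y₁ from rfl,
      Submodule.span_image, hy₁, Submodule.map_top, LinearEquiv.range]
  intro hle
  obtain ⟨d, hd, hdP⟩ := Module.exists_mem_fittingIdeal_notMem P (Localization.AtPrime P)
    (LocalizedModule.mkLinearMap P.primeCompl ((R' ⊗[R] B) ⧸ (⨆ n : ℕ,
      Submodule.torsionBy R' (R' ⊗[R] B) (c ^ n)))) (e ∘ y₁) hy
  exact hdP (hle hd)

/-- `Fit_r` of the strict transform (quotient by the `c`-power torsion, `t₁ ∣ c`, `I R' = (t₁)`)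
is everything. [cite: StacksProject, Tag 0810 (proof, Step 8)] -/
theorem fittingIdeal_strictTransform_eq_top_admissible [Module.Finite R B] {r : ℕ} {I : Ideal R}
    (hI : Module.fittingIdeal R B r = I) {t₁ c : R'} (hdiv : t₁ ∣ c)
    (hIR' : I.map (algebraMap R R') = Ideal.span {t₁}) :
    Module.fittingIdeal R' ((R' ⊗[R] B) ⧸ (⨆ n : ℕ, Submodule.torsionBy R' (R' ⊗[R] B) (c ^ n)))
      r = ⊤ := by
  by_contra hne
  obtain ⟨P, hPmax, hle⟩ := Ideal.exists_le_maximal _ hne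
  haveI := hPmax.isPrime
  refine not_fittingIdeal_strictTransform_le_admissible hdiv P ?_ hle
  rw [Module.fittingIdeal_of_isLocalizedModule P.primeCompl (Localization.AtPrime P)
      (LocalizedModule.mkLinearMap P.primeCompl (R' ⊗[R] B)) r, Module.fittingIdeal_baseChange,
    hI, hIR', Ideal.map_span, Set.image_singleton]

/-- **The strict transform along a `U`-admissible centre is locally free of rank `r`.**
[cite: RaynaudGruson1971, Première partie 5.4.2] -/
theorem nonempty_basis_localized_strictTransform_admissible [Module.Finite R B] {r : ℕ}
    {I K : Ideal R} (hI : Module.fittingIdeal R B r = I)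
    (hK : ∀ k < r, ∃ n : ℕ, K ^ n * Module.fittingIdeal R B k = ⊥)
    {t₁ c : R'} (hdiv : t₁ ∣ c) (hIR' : I.map (algebraMap R R') = Ideal.span {t₁})
    (hc : c ∈ nonZeroDivisors R') {m : ℕ} (hcK : c ^ m ∈ K.map (algebraMap R R'))
    (P : Ideal R') [P.IsPrime]
    (L : Type u) [CommRing L] [Algebra R' L] [IsLocalization.AtPrime L P]
    {M' : Type u} [AddCommGroup M'] [Module R' M'] [Module L M'] [IsScalarTower R' L M']
    (g : ((R' ⊗[R] B) ⧸ (⨆ n : ℕ, Submodule.torsionBy R' (R' ⊗[R] B) (c ^ n))) →ₗ[R'] M')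
    [IsLocalizedModule P.primeCompl g] :
    Nonempty (Module.Basis (Fin r) L M') := by
  haveI : IsLocalRing L := IsLocalization.AtPrime.isLocalRing L P
  haveI : Module.Finite L M' := Module.Finite.of_isLocalizedModule P.primeCompl g
  refine Module.nonempty_basis_of_fittingIdeal ?_ fun k hk => ?_
  · rw [Module.fittingIdeal_of_isLocalizedModule P.primeCompl L g r,
      fittingIdeal_strictTransform_eq_top_admissible hI hdiv hIR', Ideal.map_top]
  · rw [Module.fittingIdeal_of_isLocalizedModule P.primeCompl L g k,
      fittingIdeal_strictTransform_eq_bot_admissible hcK hc (hK k hk), Ideal.map_bot]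

/-- **Raynaud–Gruson 5.4.2 along a `U`-admissible blowing up.** Let `B` be a finite `R`-module
with `Fit_r(B) = I`, locally free of rank `r` over `U = Spec R ∖ V(K)` (`Kⁿ Fit_k(B) = 0` for
`k < r`). Let `R'` be an `R`-algebra with `I R' = (t₁)`, and `c` a nonzerodivisor of `R'` with
`t₁ ∣ c` and `cᵐ ∈ K R'` — every affine chart of a blowing up of `Spec R` in a centre such as
`K · I` (supported on `S ∖ U`, i.e. `U`-admissible) on which the centre becomes `(c)`. Then the
strict transform `(R' ⊗_R B)/(c-power torsion)` is a flat `R'`-module.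
[cite: RaynaudGruson1971, Première partie 5.4.2; StacksProject, Tag 0811] -/
theorem flat_strictTransform_admissible [Module.Finite R B] {r : ℕ} {I K : Ideal R}
    (hI : Module.fittingIdeal R B r = I)
    (hK : ∀ k < r, ∃ n : ℕ, K ^ n * Module.fittingIdeal R B k = ⊥)
    {t₁ c : R'} (hdiv : t₁ ∣ c) (hIR' : I.map (algebraMap R R') = Ideal.span {t₁})
    (hc : c ∈ nonZeroDivisors R') {m : ℕ} (hcK : c ^ m ∈ K.map (algebraMap R R')) :
    Module.Flat R' ((R' ⊗[R] B) ⧸ (⨆ n : ℕ, Submodule.torsionBy R' (R' ⊗[R] B) (c ^ n))) := by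
  refine Module.flat_of_localized_maximal _ fun P _ => ?_
  obtain ⟨bas⟩ := nonempty_basis_localized_strictTransform_admissible hI hK hdiv hIR' hc hcK P
    (Localization.AtPrime P) (LocalizedModule.mkLinearMap P.primeCompl _)
  haveI : Module.Free (Localization.AtPrime P) (LocalizedModule P.primeCompl
      ((R' ⊗[R] B) ⧸ (⨆ n : ℕ, Submodule.torsionBy R' (R' ⊗[R] B) (c ^ n)))) :=
    Module.Free.of_basis bas
  exact (Module.flat_iff_of_isLocalization (Localization.AtPrime P) P.primeCompl _).mp
    inferInstance

end Literature.AlgebraicGeometry.Resolution
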